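import Mathlib
import Literature.NumberTheory.LFunctions.Zhang2022.SkeletonPartThree
import HarnessLib

/-!
# Zhang (2022) §8, proof of Lemma 8.1 (Z22:Lem8.1.pf, pp. 42–44): preliminaries for the kernel edge
# «displayed steps ⇒ Lemma 8.1» — parameter sizes, `#Ψ ≤ 𝔓`, continuity, bookkeeping, budget

Topic `Literature/NumberTheory/LFunctions/Zhang2022` (Landau–Siegel adjudication tree;
verdict-neutral). Y. Zhang, *Discrete mean estimates and the Landau–Siegel zero*,
arXiv:2211.02515v1 (2022) [Zhang2022LandauSiegel] — **an unrefereed manuscript under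
adjudication; nothing here asserts any of its claims.** Cell siegel-zhang (D-0069 width
campaign), discharge node **D21 / cone C19 = `Skeleton.Ded81 c′`** (the deduction
`Prop22 → Lemma33b → Lemma52 → Lemma59 → Lemma61 → Lemma81` of `SkeletonPartThree`), §8
pp. 42–44, tex L2193–2265.

This file holds the elementary, claim-free ingredients of the edge proved in `Section8Ded81.lean`
(`Skeleton.lemma81_of_steps`):

* §0 `exists_params_large` — for every real `c′` and all large `D`: `b₁,b₂,b₃ ≥ 0`
  (`β_j = ib_j`, (2.13)), `|𝓛₁| < 2πt₀`, `|α| ≤ 𝓛₂`, … (the side conditions of the tree's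
  reflection `Lemma81.neg_Itilde_neg_eq_conj` and of (7.4)
  `SmoothWeight.integral_norm_omega_segment_le_of_abs_le`);
* §1 `card_finsetOf_psiOne_le_frakP` — `#Ψ₁ ≤ #Ψ ≤ Σ_{p∼P} φ(p) ≤ 𝔓` (what turns the summed
  `O(ε)` of (8.1) into `o(𝔓)`);
* §3 continuity of `L(·,ψ)`, `A(a;·,ψ)`, `ω` along vertical lines (for `Σ_ψ∫ = ∫Σ_ψ`);
* §4 `norm_sum_sub_le_of_steps`, `sum_le_mul_integral_of_pointwise` — the abstract bookkeeping;
* §5 `exists_frakP_ge_half`, `exists_two_le_frakP`, `exists_large_exp_le`, `exists_large_main_le`,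
  `adm72_conj` — the error budget: `K·e^{−c𝓛¹⁰} → 0`, `K·P²𝓛⁻⁷⁸ ≤ ε𝔓` ((2.9), tree `frakP_bounds`),
  and (7.2) under conjugation.

No definitions, no new named facts. WHAT THIS IS NOT: any claim about Lemma 8.1's truth, Theorems
1–2 of the source, or Landau–Siegel zeros.

## References

* Y. Zhang, arXiv:2211.02515v1 (2022), §8 Lemma 8.1 pp. 42–44; §2 (2.9), (2.13), (2.15); §7 (7.2),
  (7.4). [cite: Zhang2022LandauSiegel, §8 Lemma 8.1 pp.42–44]
-/

noncomputable section

open Complex Real ComplexConjugate MeasureTheory Set Filter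

namespace Literature.NumberTheory.LFunctions.Zhang2022.Ded81Edge

open Skeleton

/-! ## §0. Elementary facts about the parameters for large `D` -/

/-- `log D → ∞` along the naturals. [folklore] -/
private theorem tendsto_ell_atTop : Tendsto (fun D : ℕ => ell D) atTop atTop :=
  Real.tendsto_log_atTop.comp tendsto_natCast_atTop_atTop

/-- For every real `M` there is `D₀` with `M ≤ 𝓛 = log D` for all `D ≥ D₀`. [folklore] -/
private theorem exists_nat_forall_le_ell (M : ℝ) : ∃ D₀ : ℕ, ∀ D : ℕ, D₀ ≤ D → M ≤ ell D := by
  have h := (tendsto_ell_atTop.eventually (eventually_ge_atTop M))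
  rw [eventually_atTop] at h
  exact h

/-- `α·𝓛 = π𝓛⁻⁸` for `𝓛 ≠ 0` ((2.10): `α = π/log P = π𝓛⁻⁹`). [folklore] -/
private theorem alpha_mul_ell' (D : ℕ) (h : ell D ≠ 0) : alpha D * ell D = π / ell D ^ 8 := by
  rw [alpha, bigP, Real.log_exp]; field_simp

/-- **The shifts are non-negative imaginary for large `D`**: for every real `c′` there is `D₀` with
`0 ≤ b₁, b₂, b₃` (`β_j = ib_j`, (2.13)), `|𝓛₁| < 2πt₀`, `|α| ≤ 𝓛₂`, `0 ≤ 𝓛₁`, `0 < 𝓛₂`, `1 ≤ 𝓛`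
for all `D ≥ D₀` — the side conditions of the tree's reflection `Lemma81.neg_Itilde_neg_eq_conj`
and of (7.4) `SmoothWeight.integral_norm_omega_segment_le_of_abs_le`.
[cite: Zhang2022LandauSiegel, §2 (2.8), (2.13), (2.15)] -/
theorem exists_params_large (c' : ℝ) : ∃ D₀ : ℕ, ∀ D : ℕ, D₀ ≤ D →
    1 ≤ ell D ∧ 0 ≤ b1 c' D ∧ 0 ≤ b2 c' D ∧ 0 ≤ b3 c' D ∧ |ell1 D| < 2 * π * t0 D ∧
      |alpha D| ≤ ell2 D ∧ 0 ≤ ell1 D ∧ 0 < ell2 D ∧ 0 < alpha D := by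
  obtain ⟨D₀, hD₀⟩ := exists_nat_forall_le_ell (max 2 (5 * π * |c'| + 1))
  refine ⟨D₀, fun D hD => ?_⟩
  have hL := hD₀ D hD
  have hL2 : 2 ≤ ell D := le_trans (le_max_left _ _) hL
  have hLc : 5 * π * |c'| + 1 ≤ ell D := le_trans (le_max_right _ _) hL
  have hL1 : 1 ≤ ell D := by linarith
  have hL0 : 0 < ell D := by linarith
  have hπ := Real.pi_pos
  have hα : alpha D = π / ell D ^ 9 := by rw [alpha, bigP, Real.log_exp]
  have hα0 : 0 < alpha D := by rw [hα]; positivity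
  -- `|c′| α 𝓛 ≤ 1/5`
  have hL8 : ell D ≤ ell D ^ 8 := by
    calc ell D = ell D ^ 1 := (pow_one _).symm
      _ ≤ ell D ^ 8 := pow_le_pow_right₀ hL1 (by norm_num)
  have hcαL : |c'| * (alpha D * ell D) ≤ 1 / 5 := by
    rw [alpha_mul_ell' D hL0.ne']
    rw [show |c'| * (π / ell D ^ 8) = (5 * π * |c'|) / ell D ^ 8 / 5 by ring]
    have h8 : 0 < ell D ^ 8 := by positivity
    have : 5 * π * |c'| / ell D ^ 8 ≤ 1 := by
      rw [div_le_one h8]; linarith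
    linarith
  have hαL0 : 0 ≤ alpha D * ell D := by positivity
  have habs : |c' * (alpha D * ell D)| = |c'| * (alpha D * ell D) := by
    rw [abs_mul, abs_of_nonneg hαL0]
  have hc1 : c' * (alpha D * ell D) ≤ 1 / 5 := le_trans (le_abs_self _) (habs ▸ hcαL)
  have hc2 : -(c' * (alpha D * ell D)) ≤ 1 / 5 := le_trans (neg_le_abs _) (habs ▸ hcαL)
  refine ⟨hL1, ?_, ?_, ?_, ?_, ?_, by rw [ell1]; positivity, by rw [ell2]; positivity, hα0⟩
  · rw [b1]
    apply mul_nonneg hα0.le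
    nlinarith
  · rw [b2]
    apply mul_nonneg (by positivity)
    nlinarith
  · rw [b3]
    apply mul_nonneg (by positivity)
    nlinarith
  · rw [ell1, t0, abs_of_nonneg (by positivity)]
    have h1 : ell D ^ 405 ≤ ell D ^ 519 := pow_le_pow_right₀ hL1 (by norm_num)
    have h2 : 0 < ell D ^ 519 := by positivity
    nlinarith [Real.pi_gt_three]
  · rw [hα, ell2, abs_of_nonneg (by positivity)]
    have h9 : 1 ≤ ell D ^ 9 := one_le_pow₀ hL1
    have h400 : 1 ≤ ell D ^ 400 := one_le_pow₀ hL1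
    have h9' : (4 : ℝ) ≤ ell D ^ 9 := by
      calc (4 : ℝ) = 2 ^ 2 := by norm_num
        _ ≤ ell D ^ 2 := pow_le_pow_left₀ (by norm_num) hL2 2
        _ ≤ ell D ^ 9 := pow_le_pow_right₀ hL1 (by norm_num)
    calc π / ell D ^ 9 ≤ π / 4 := by gcongr
      _ ≤ 1 := by linarith [Real.pi_lt_four]
      _ ≤ ell D ^ 400 := h400

/-! ## §1. `#Ψ₁ ≤ #Ψ ≤ 𝔓` (the count behind "`Σ_{ψ∈Ψ₁} O(ε) = o(𝔓)`") -/

/-- `Ψ ↪ Σ_{p∼P} {characters mod p}` is injective (the tree's `Chr.toSigma`). [folklore] -/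
private theorem Chr.toSigma_injective'' {D : ℕ} : Function.Injective (Chr.toSigma (D := D)) := by
  rintro ⟨p, hp, ψ, hψ⟩ ⟨p', hp', ψ', hψ'⟩ h
  simp only [Chr.toSigma, Sigma.mk.injEq, Subtype.mk.injEq] at h
  obtain ⟨rfl, h2⟩ := h
  simp only [heq_eq_eq] at h2
  subst h2
  rfl

/-- **`#Ψ ≤ 𝔓`**: the family `Ψ` of primitive characters `ψ (mod p)`, `p ∼ P`, has at most
`Σ_{p∼P} φ(p) ≤ Σ_{p∼P} p = 𝔓` members ((2.9)). [cite: Zhang2022LandauSiegel, §2 (2.9)] -/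
theorem natCard_chr_le_frakP (D : ℕ) : (Nat.card (Chr D) : ℝ) ≤ frakP D := by
  classical
  have h1 : Nat.card (Chr D) ≤ Nat.card ((q : primeWindow D) × DirichletCharacter ℂ (q : ℕ)) :=
    Nat.card_le_card_of_injective _ Chr.toSigma_injective''
  have h2 : Nat.card ((q : primeWindow D) × DirichletCharacter ℂ (q : ℕ)) =
      ∑ q : primeWindow D, Nat.card (DirichletCharacter ℂ (q : ℕ)) := Nat.card_sigma
  have h3 : ∑ q : primeWindow D, Nat.card (DirichletCharacter ℂ (q : ℕ)) ≤
      ∑ q : primeWindow D, (q : ℕ) := by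
    refine Finset.sum_le_sum fun q _ => ?_
    rw [DirichletCharacter.card_eq_totient_of_hasEnoughRootsOfUnity ℂ (q : ℕ)]
    exact Nat.totient_le _
  have h4 : ∑ q : primeWindow D, ((q : ℕ) : ℝ) = frakP D := by
    rw [frakP_eq_sum_primeWindow, ← Finset.sum_coe_sort (primeWindow D)]
  calc (Nat.card (Chr D) : ℝ) ≤ ((∑ q : primeWindow D, (q : ℕ) : ℕ) : ℝ) := by
        exact_mod_cast h1.trans (h2 ▸ h3)
    _ = frakP D := by push_cast; exact h4

/-- **`#Ψ₁ ≤ 𝔓`** for the `Finset` form of `Ψ₁` used in the discrete means.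
[cite: Zhang2022LandauSiegel, §2 (2.9); §3 p. 7] -/
theorem card_finsetOf_psiOne_le_frakP {D : ℕ} [NeZero D] (χ : DirichletCharacter ℂ D) :
    ((finsetOf (PsiOne χ)).card : ℝ) ≤ frakP D := by
  classical
  haveI : Fintype (Chr D) := Fintype.ofFinite (Chr D)
  have h : (finsetOf (PsiOne χ)).card ≤ Nat.card (Chr D) := by
    rw [Nat.card_eq_fintype_card]; exact Finset.card_le_univ _
  exact le_trans (by exact_mod_cast h) (natCard_chr_le_frakP D)

/-! ## §3. Continuity of the integrands along a vertical line (for the interchange `Σ_ψ ∫ = ∫ Σ_ψ`) -/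

/-- A Dirichlet character to a modulus `k ≠ 1` vanishes at `0`. [folklore] -/
private theorem dirichletCharacter_apply_zero {k : ℕ} [NeZero k] (θ : DirichletCharacter ℂ k) (hk : k ≠ 1) :
    θ (0 : ZMod k) = 0 := by
  haveI : Nontrivial (ZMod k) := ZMod.nontrivial_iff.mpr hk
  exact MulChar.map_nonunit θ not_isUnit_zero

/-- The finite Dirichlet polynomial `A(a;s,θ)` is continuous in `s` (modulus `k ≠ 1`, so the
`n = 0` term vanishes). [cite: Zhang2022LandauSiegel, §7 p. 32 (after (7.2))] -/
theorem continuous_dirPoly {k : ℕ} [NeZero k] (N : ℕ) (a : ℕ → ℂ) (θ : DirichletCharacter ℂ k)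
    (hk : k ≠ 1) : Continuous (Lemma81.dirPoly N a θ) := by
  have h : Lemma81.dirPoly N a θ = fun s => ∑ n ∈ Finset.range N, a n * θ n * (n : ℂ) ^ (-s) := by
    funext s; rw [Lemma81.dirPoly_def]
  rw [h]
  refine continuous_finsetSum _ fun n _ => ?_
  rcases Nat.eq_zero_or_pos n with rfl | hn
  · have h0 : (θ ((0 : ℕ) : ZMod k)) = 0 := by
      rw [Nat.cast_zero]; exact dirichletCharacter_apply_zero θ hk
    simp only [h0, mul_zero, zero_mul]
    exact continuous_const
  · exact continuous_const.mul
      (Continuous.const_cpow continuous_neg (Or.inl (Nat.cast_ne_zero.mpr hn.ne')))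

/-- The weight `ω` of (2.15) is continuous (entire). [cite: Zhang2022LandauSiegel, §2 (2.15)] -/
theorem continuous_omega (L₂ t₀ : ℝ) : Continuous (SmoothWeight.omega L₂ t₀) := by
  have h : SmoothWeight.omega L₂ t₀ =
      fun s => ((Real.sqrt π / L₂ : ℝ) : ℂ) * cexp ((s - SmoothWeight.s0 t₀) ^ 2 / (4 * (L₂ : ℂ) ^ 2)) := by
    funext s; rw [SmoothWeight.omega_def]
  rw [h]
  fun_prop

/-- `L(s,ψ)` is continuous for `ψ ∈ Ψ` (non-principal, so entire) — implicit in §8 p. 44, where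
`|L(s+β₂,ψ)L(s+β₃,ψ)…|` is integrated along `𝔍(α)`. [cite: Zhang2022LandauSiegel, §8 p. 44] -/
theorem continuous_LFunction_chr {D : ℕ} (x : Chr D) : Continuous x.ψ.LFunction :=
  (DirichletCharacter.differentiable_LFunction x.ψ_ne_one).continuous

/-! ## §4. Two abstract bookkeeping lemmas -/

/-- **The error bookkeeping of Lemma 8.1's proof** (§8 pp. 43–44), abstractly: if for every `ψ` in
a finite family the discrete mean `S_ψ` is `Ĩ⁺_ψ − Ĩ⁻_ψ` up to `e₁`, `−Ĩ⁻_ψ = conj Ĩ⁺_ψ(ā₂,ā₁)`,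
the `Ĩ⁺` are close to the `I⁺` in `ℓ¹` over the family (both for `(a₁,a₂)` and `(ā₂,ā₁)`), and the
family sums of `I⁺` are `Θ`, `Θ′` up to `e₃`, then `Σ_ψ S_ψ = Θ + conj Θ′` up to
`#family·e₁ + 2e₂ + 2e₃`. [cite: Zhang2022LandauSiegel, §8 pp. 43–44 (proof of Lemma 8.1)] -/
theorem norm_sum_sub_le_of_steps {ι : Type*} (s : Finset ι) (S Ip Im Ipc J Jc : ι → ℂ)
    (Θ Θc : ℂ) {e₁ e₂ e₃ : ℝ}
    (h1 : ∀ x ∈ s, ‖S x - (Ip x - Im x)‖ ≤ e₁)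
    (h2 : ∀ x ∈ s, -Im x = conj (Ipc x))
    (h3 : ∑ x ∈ s, ‖Ip x - J x‖ ≤ e₂) (h3c : ∑ x ∈ s, ‖Ipc x - Jc x‖ ≤ e₂)
    (h4 : ‖∑ x ∈ s, J x - Θ‖ ≤ e₃) (h4c : ‖∑ x ∈ s, Jc x - Θc‖ ≤ e₃) :
    ‖∑ x ∈ s, S x - (Θ + conj Θc)‖ ≤ s.card * e₁ + 2 * e₂ + 2 * e₃ := by
  -- per-`ψ` decomposition of the error
  have key : ∀ x ∈ s, S x = J x + conj (Jc x) +
      ((S x - (Ip x - Im x)) + (Ip x - J x) + conj (Ipc x - Jc x)) := by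
    intro x hx
    have e := h2 x hx
    have : Im x = -conj (Ipc x) := by rw [← e, neg_neg]
    rw [this, map_sub]
    ring
  rw [Finset.sum_congr rfl key, Finset.sum_add_distrib, Finset.sum_add_distrib,
    Finset.sum_add_distrib, Finset.sum_add_distrib, ← map_sum (starRingEnd ℂ) (fun x => Jc x) s]
  have eq : ∑ x ∈ s, J x + conj (∑ x ∈ s, Jc x) +
        (∑ x ∈ s, (S x - (Ip x - Im x)) + ∑ x ∈ s, (Ip x - J x) +
          ∑ x ∈ s, conj (Ipc x - Jc x)) - (Θ + conj Θc)
      = (∑ x ∈ s, J x - Θ) + conj (∑ x ∈ s, Jc x - Θc) +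
        (∑ x ∈ s, (S x - (Ip x - Im x)) + ∑ x ∈ s, (Ip x - J x) +
          ∑ x ∈ s, conj (Ipc x - Jc x)) := by
    rw [map_sub]; ring
  rw [eq]
  have n1 : ‖∑ x ∈ s, (S x - (Ip x - Im x))‖ ≤ s.card * e₁ := by
    calc ‖∑ x ∈ s, (S x - (Ip x - Im x))‖ ≤ ∑ x ∈ s, ‖S x - (Ip x - Im x)‖ := norm_sum_le _ _
      _ ≤ ∑ x ∈ s, e₁ := Finset.sum_le_sum h1
      _ = s.card * e₁ := by rw [Finset.sum_const, nsmul_eq_mul]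
  have n2 : ‖∑ x ∈ s, (Ip x - J x)‖ ≤ e₂ := (norm_sum_le _ _).trans h3
  have n3 : ‖∑ x ∈ s, conj (Ipc x - Jc x)‖ ≤ e₂ := by
    rw [← map_sum, Complex.norm_conj]
    exact (norm_sum_le _ _).trans h3c
  have n4 : ‖conj (∑ x ∈ s, Jc x - Θc)‖ ≤ e₃ := by rw [Complex.norm_conj]; exact h4c
  calc ‖(∑ x ∈ s, J x - Θ) + conj (∑ x ∈ s, Jc x - Θc) +
        (∑ x ∈ s, (S x - (Ip x - Im x)) + ∑ x ∈ s, (Ip x - J x) +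
          ∑ x ∈ s, conj (Ipc x - Jc x))‖
      ≤ ‖∑ x ∈ s, J x - Θ‖ + ‖conj (∑ x ∈ s, Jc x - Θc)‖ +
        (‖∑ x ∈ s, (S x - (Ip x - Im x))‖ + ‖∑ x ∈ s, (Ip x - J x)‖ +
          ‖∑ x ∈ s, conj (Ipc x - Jc x)‖) := by
        refine (norm_add_le _ _).trans (add_le_add (norm_add_le _ _) ?_)
        exact (norm_add_le _ _).trans (add_le_add (norm_add_le _ _) le_rfl)
    _ ≤ e₃ + e₃ + (s.card * e₁ + e₂ + e₂) := by gcongr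
    _ = s.card * e₁ + 2 * e₂ + 2 * e₃ := by ring

/-- **"These estimates together with (7.4) … imply"** (§8 p. 44, Z22:§8.u014), abstractly: if each
`F_ψ ≤ c∫_a^b g_ψ` with `g_ψ ≥ 0` continuous, and `Σ_ψ g_ψ ≤ G` pointwise on `[a,b]` with `G`
continuous, then `Σ_ψ F_ψ ≤ c∫_a^b G` (interchange of the finite sum and the integral, then
monotonicity). [cite: Zhang2022LandauSiegel, §8 p. 44 (proof of Lemma 8.1)] -/
theorem sum_le_mul_integral_of_pointwise {ι : Type*} (s : Finset ι) (F : ι → ℝ)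
    (g : ι → ℝ → ℝ) (G : ℝ → ℝ) {a b c : ℝ} (hab : a ≤ b) (hc : 0 ≤ c)
    (hF : ∀ x ∈ s, F x ≤ c * ∫ v in a..b, g x v) (hg : ∀ x ∈ s, Continuous (g x))
    (hG : Continuous G) (hle : ∀ v ∈ Icc a b, ∑ x ∈ s, g x v ≤ G v) :
    ∑ x ∈ s, F x ≤ c * ∫ v in a..b, G v := by
  have hgi : ∀ x ∈ s, IntervalIntegrable (g x) volume a b :=
    fun x hx => (hg x hx).intervalIntegrable a b
  calc ∑ x ∈ s, F x ≤ ∑ x ∈ s, c * ∫ v in a..b, g x v := Finset.sum_le_sum hF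
    _ = c * ∫ v in a..b, ∑ x ∈ s, g x v := by
        rw [← Finset.mul_sum, intervalIntegral.integral_finsetSum hgi]
    _ ≤ c * ∫ v in a..b, G v := by
        refine mul_le_mul_of_nonneg_left ?_ hc
        refine intervalIntegral.integral_mono_on hab ?_ (hG.intervalIntegrable a b) hle
        exact (continuous_finsetSum s hg).intervalIntegrable a b

/-! ## §5. More facts for large `D`: the error budget -/

/-- **`𝔓 ≥ ½P²𝓛⁻⁷⁷` for large `D`** ((2.9), from the tree's `frakP_bounds`).
[cite: Zhang2022LandauSiegel, §2 (2.9)] -/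
theorem exists_frakP_ge_half : ∃ D₀ : ℕ, ∀ D : ℕ, D₀ ≤ D →
    Real.exp (ell D ^ 9) ^ 2 * (ell D ^ 77)⁻¹ / 2 ≤ frakP D := by
  obtain ⟨D₀, h⟩ := frakP_bounds
  obtain ⟨D₁, hD₁⟩ := exists_nat_forall_le_ell 2
  refine ⟨max D₀ D₁, fun D hD => ?_⟩
  have hD₀ : D₀ ≤ D := le_trans (le_max_left _ _) hD
  have hL2 : 2 ≤ ell D := hD₁ D (le_trans (le_max_right _ _) hD)
  set L := ell D with hL
  set M := Real.exp (L ^ 9) ^ 2 * (L ^ 77)⁻¹ with hM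
  have hM0 : 0 < M := by positivity
  have hb := (abs_le.mp (h D hD₀)).1
  change -(3 * (L ^ 68)⁻¹ * M) ≤ frakP D - M at hb
  have hL68 : (6 : ℝ) ≤ L ^ 68 := by
    calc (6 : ℝ) ≤ 2 ^ 68 := by norm_num
      _ ≤ L ^ 68 := by gcongr
  have hsmall : 3 * (L ^ 68)⁻¹ ≤ 1 / 2 := by
    rw [mul_inv_le_iff₀ (by positivity)]; linarith
  nlinarith [mul_le_mul_of_nonneg_right hsmall hM0.le]

/-- **`2 ≤ 𝔓` for large `D`**: the window `p ∼ P` is eventually non-empty (`frakP_eventually_pos`)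
and every prime is at least `2`. [cite: Zhang2022LandauSiegel, §2 (2.9)] -/
theorem exists_two_le_frakP : ∃ D₀ : ℕ, ∀ D : ℕ, D₀ ≤ D → 2 ≤ frakP D := by
  obtain ⟨D₀, h⟩ := frakP_eventually_pos
  refine ⟨D₀, fun D hD => ?_⟩
  have hpos := h D hD
  rw [frakP_eq_sum_primeWindow] at hpos ⊢
  obtain ⟨p, hp, -⟩ := Finset.exists_ne_zero_of_sum_ne_zero hpos.ne'
  have hp2 : (2 : ℝ) ≤ p := by exact_mod_cast (Finset.mem_filter.mp hp).2.two_le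
  exact hp2.trans (Finset.single_le_sum (fun q _ => Nat.cast_nonneg q) hp)

/-- `K·e^{−c𝓛¹⁰} ≤ ε` for large `D` (`c, ε > 0`): the "`O(ε)`", `ε = exp{−c𝓛¹⁰}`, terms of §8 are
eventually below any positive threshold. [cite: Zhang2022LandauSiegel, §5 p. 24 (`ε`)] -/
theorem exists_large_exp_le (K c ε : ℝ) (hc : 0 < c) (hε : 0 < ε) :
    ∃ D₀ : ℕ, ∀ D : ℕ, D₀ ≤ D → K * Real.exp (-c * ell D ^ 10) ≤ ε := by
  obtain ⟨D₀, hD₀⟩ := exists_nat_forall_le_ell (max 1 ((|K| / ε + 1) / c))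
  refine ⟨D₀, fun D hD => ?_⟩
  rw [neg_mul]
  have hL := hD₀ D hD
  have hL1 : 1 ≤ ell D := le_trans (le_max_left _ _) hL
  have hLc : (|K| / ε + 1) / c ≤ ell D := le_trans (le_max_right _ _) hL
  have hcL : |K| / ε + 1 ≤ c * ell D := by
    rw [div_le_iff₀ hc] at hLc; linarith
  have h10 : ell D ≤ ell D ^ 10 := by
    calc ell D = ell D ^ 1 := (pow_one _).symm
      _ ≤ ell D ^ 10 := pow_le_pow_right₀ hL1 (by norm_num)
  -- `e^{c𝓛¹⁰} ≥ e^{c𝓛} ≥ 1 + c𝓛 > |K|/ε`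
  have hexp : |K| / ε + 1 ≤ Real.exp (c * ell D ^ 10) := by
    calc |K| / ε + 1 ≤ c * ell D := hcL
      _ ≤ c * ell D ^ 10 := by gcongr
      _ ≤ c * ell D ^ 10 + 1 := by linarith
      _ ≤ Real.exp (c * ell D ^ 10) := Real.add_one_le_exp _
  have hpos : 0 < Real.exp (c * ell D ^ 10) := Real.exp_pos _
  rw [Real.exp_neg]
  have hK : K ≤ |K| := le_abs_self K
  have h1 : |K| ≤ ε * Real.exp (c * ell D ^ 10) := by
    have : |K| / ε ≤ Real.exp (c * ell D ^ 10) := by linarith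
    rwa [div_le_iff₀ hε, mul_comm] at this
  calc K * (Real.exp (c * ell D ^ 10))⁻¹ ≤ |K| * (Real.exp (c * ell D ^ 10))⁻¹ := by
        gcongr
    _ ≤ ε * Real.exp (c * ell D ^ 10) * (Real.exp (c * ell D ^ 10))⁻¹ := by gcongr
    _ = ε := by field_simp

/-- `K·P²𝓛⁻⁷⁸ ≤ ε𝔓` for large `D` (`ε > 0`): the bound `≪ P²𝓛^{36−114}∫|ω|` of §8 p. 44 is
`o(𝔓)` by (2.9) `𝔓 ≍ P²𝓛⁻⁷⁷`. [cite: Zhang2022LandauSiegel, §8 p. 44; §2 (2.9)] -/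
theorem exists_large_main_le (K ε : ℝ) (hε : 0 < ε) :
    ∃ D₀ : ℕ, ∀ D : ℕ, D₀ ≤ D →
      K * (bigP D ^ 2 * ell D ^ 36 * (ell D ^ 114)⁻¹) ≤ ε * frakP D := by
  obtain ⟨D₀, hD₀⟩ := exists_frakP_ge_half
  obtain ⟨D₁, hD₁⟩ := exists_nat_forall_le_ell (max 1 (2 * |K| / ε))
  refine ⟨max D₀ D₁, fun D hD => ?_⟩
  have hP := hD₀ D (le_trans (le_max_left _ _) hD)
  have hL := hD₁ D (le_trans (le_max_right _ _) hD)
  have hL1 : 1 ≤ ell D := le_trans (le_max_left _ _) hL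
  have hLK : 2 * |K| / ε ≤ ell D := le_trans (le_max_right _ _) hL
  have hL0 : 0 < ell D := by linarith
  set L := ell D with hLdef
  set M := Real.exp (L ^ 9) ^ 2 * (L ^ 77)⁻¹ with hM
  have hM0 : 0 < M := by positivity
  have hPexp : bigP D = Real.exp (L ^ 9) := rfl
  -- `P²𝓛³⁶𝓛⁻¹¹⁴ = M / 𝓛`
  have hid : bigP D ^ 2 * L ^ 36 * (L ^ 114)⁻¹ = M / L := by
    rw [hPexp, hM]; field_simp
  rw [hid]
  have hKL : |K| / L ≤ ε / 2 := by
    rw [div_le_iff₀ hL0]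
    rw [div_le_iff₀ hε] at hLK
    linarith
  calc K * (M / L) ≤ |K| * (M / L) := by gcongr; exact le_abs_self K
    _ = |K| / L * M := by ring
    _ ≤ ε / 2 * M := by gcongr
    _ = ε * (M / 2) := by ring
    _ ≤ ε * frakP D := by gcongr

/-- **(7.2) is stable under conjugation**: `ā = {conj a(n)}` satisfies (7.2) with the same bound.
[cite: Zhang2022LandauSiegel, §7 (7.2); §8 Lemma 8.1] -/
theorem adm72_conj {D : ℕ} {B : ℝ} {a : ℕ → ℂ} (h : Adm72 D B a) :
    Adm72 D B fun n => conj (a n) := by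
  refine ⟨fun n => ?_, fun n hn => ?_⟩
  · rw [Complex.norm_conj]; exact h.1 n
  · show conj (a n) = 0
    rw [h.2 n hn, map_zero]

end Literature.NumberTheory.LFunctions.Zhang2022.Ded81Edge
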